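import Summits.CriticalPhenomena.PercolationContinuityZ3.Theorems.PercNearOneGluingNoHeavyPcintMemCertZ3T6
import Summits.CriticalPhenomena.PercolationContinuityZ3.Theorems.PercNearOneGluingNoHeavyPcintClosingCountKernel
import Summits.CriticalPhenomena.PercolationContinuityZ3.Theorems.PercNearOneGluingNoHeavyPcintLoopExclusionRungFourCounts
import HarnessLib

/-!
# CriticalPhenomena/PercolationContinuityZ3 — Theorems/PercNearOneGluingNoHeavyPcintLoopExclusionRungSixZ3.lean: the second rung of the typed law C4 on `ℤ³` — `0 < R_6(ℤ³) ≤ 0.6 < 0.7 ≤ R_4(ℤ³) < 1`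

Lane prim-pcint, STRUCTURE rule (a law stated as theorems).  The loop-exclusion factor `R_τ(d) = Δ_τ/f_τ` of the typed law C4
(…PcintLoopExclusionLaw: `loopCompatWindow` (a) `0 < R < 1`, `loopCompatStrictAntiMemory` (c) `R_{τ+2} < R_τ`) is known in
the tree in closed form at the first rung (`R_4`, …RungFourCounts) and positive at the second (`R_6 > 0`, …MemorySixStrict).
On the headline lattice `ℤ³` this file certifies the whole second-rung picture:

* `memLoopDensity_six_zd3_ge/le`: `264/4.86454⁶ ≤ f_6(ℤ³) = 264/μ_4⁶ ≤ 264/4.8645⁶` (the EXACT hexagon count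
  `closingCount_six_zd3` of …ClosingCountKernel and the Fisher–Sykes root brackets `4.8645 ≤ μ_4(ℤ³) ≤ 4.86454`);
* **`loopCompat_six_zd3_le` / `loopCompat_six_zd3_ge`: `0.58 ≤ R_6(ℤ³) ≤ 0.6`** (with the kernel certificate
  `0.0117 ≤ Δ_6(ℤ³) ≤ 0.0119` of …MemCertZ3T6; measured `R_6(ℤ³) = 0.5935`);
* **`loopCompat_four_zd3_ge` / `_le`: `0.7 ≤ R_4(ℤ³) ≤ 0.73`** (closed form `(625/24)·ln(5/μ_4)`, `1 − 1/t ≤ ln t ≤ t − 1`; measured 0.7153);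
* hence **`loopCompat_six_lt_four_zd3`: `R_6(ℤ³) < R_4(ℤ³)`** — clause (c) of C4 at its first instance `(d, m) = (3, 2)`
  (`loopCompatStrictAntiMemory_three_two`) — and **`loopCompatWindow_three_three`: `0 < R_6(ℤ³) < 1`** — clause (a) at `(3, 3)`.

HONEST FRAMING: elementary consequences of kernel certificates and a kernel count; nothing here is used by a certified `p_c` cell.
Written by prim-pcint-2 gen 17 (prover-prim-pcint-2-g17-0), 2026-08-25.
-/

noncomputable section

open Literature.Probability.LatticeModels Literature.Probability.Percolation
open Summit.CriticalPhenomena.PercolationContinuityZ3.Theorems.Pcint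

namespace Summit.CriticalPhenomena.PercolationContinuityZ3.Theorems.Pcint.MemoryTail

/-- **`f_6(ℤ³) ≥ 264/4.86454⁶`** (`≈ 0.019923`; measured `f_6(ℤ³) = 264/μ_4⁶ = 0.019925`). [this work] -/
theorem memLoopDensity_six_zd3_ge : (264 : ℝ) / 4.86454 ^ 6 ≤ memLoopDensity 3 6 := by
  unfold memLoopDensity
  rw [show (6 : ℕ) - 2 = 4 from rfl]
  have hμlo : (4.8645 : ℝ) ≤ memGrowth 3 4 := le_memGrowth_four_of_cubic_nonpos (d := 3) (by norm_num) (by norm_num) (by norm_num)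
  have hμhi : memGrowth 3 4 ≤ 4.86454 := memGrowth_four_zd3_le
  have hμpos : (0 : ℝ) < memGrowth 3 4 := by linarith
  have hcc : ((closingCount 3 6 : ℕ) : ℝ) = 264 := by rw [closingCount_six_zd3]; norm_num
  rw [hcc]
  exact div_le_div_of_nonneg_left (by norm_num) (by positivity) (pow_le_pow_left₀ hμpos.le hμhi 6)

/-- **`f_6(ℤ³) ≤ 264/4.8645⁶`** (`≈ 0.019924`). [this work] -/
theorem memLoopDensity_six_zd3_le : memLoopDensity 3 6 ≤ (264 : ℝ) / 4.8645 ^ 6 := by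
  unfold memLoopDensity
  rw [show (6 : ℕ) - 2 = 4 from rfl]
  have hμlo : (4.8645 : ℝ) ≤ memGrowth 3 4 := le_memGrowth_four_of_cubic_nonpos (d := 3) (by norm_num) (by norm_num) (by norm_num)
  have hcc : ((closingCount 3 6 : ℕ) : ℝ) = 264 := by rw [closingCount_six_zd3]; norm_num
  rw [hcc]
  exact div_le_div_of_nonneg_left (by norm_num) (by positivity) (pow_le_pow_left₀ (by norm_num) hμlo 6)

/-- `f_6(ℤ³) > 0`. [this work] -/
theorem memLoopDensity_six_zd3_pos : 0 < memLoopDensity 3 6 :=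
  lt_of_lt_of_le (by norm_num) memLoopDensity_six_zd3_ge

/-- **`R_6(ℤ³) ≤ 0.6`** (`Δ_6(ℤ³) ≤ 0.0119`, `f_6(ℤ³) ≥ 264/4.86454⁶`; measured 0.5935). [this work] -/
theorem loopCompat_six_zd3_le : loopCompat 3 6 ≤ 0.6 := by
  unfold loopCompat
  have hf := memLoopDensity_six_zd3_ge
  have hfpos := memLoopDensity_six_zd3_pos
  have hΔ := memLoopCost_six_zd3_bounds.2
  rw [div_le_iff₀ hfpos]
  have : (0.0119 : ℝ) ≤ 0.6 * ((264 : ℝ) / 4.86454 ^ 6) := by norm_num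
  nlinarith

/-- **`0 < R_6(ℤ³)`** (`Δ_6(ℤ³) ≥ 0.0117 > 0`). [this work] -/
theorem loopCompat_six_zd3_pos : 0 < loopCompat 3 6 := by
  unfold loopCompat
  exact div_pos (lt_of_lt_of_le (by norm_num) memLoopCost_six_zd3_bounds.1) memLoopDensity_six_zd3_pos

/-- **`0.58 ≤ R_6(ℤ³)`** (`Δ_6(ℤ³) ≥ 0.0117`, `f_6(ℤ³) ≤ 264/4.8645⁶`). [this work] -/
theorem loopCompat_six_zd3_ge : (0.58 : ℝ) ≤ loopCompat 3 6 := by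
  unfold loopCompat
  have hf := memLoopDensity_six_zd3_le
  have hfpos := memLoopDensity_six_zd3_pos
  have hΔ := memLoopCost_six_zd3_bounds.1
  rw [le_div_iff₀ hfpos]
  have : 0.58 * ((264 : ℝ) / 4.8645 ^ 6) ≤ 0.0117 := by norm_num
  nlinarith

/-- **`0.7 ≤ R_4(ℤ³)`** (`R_4(ℤ³) = (625/24)·ln(5/μ_4) ≥ (625/24)(1 − μ_4/5)` with `μ_4(ℤ³) ≤ 4.86454`; measured 0.7153). [this work] -/
theorem loopCompat_four_zd3_ge : (0.7 : ℝ) ≤ loopCompat 3 4 := by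
  rw [loopCompat_four_eq (d := 3) (by norm_num)]
  have hμlo : (4.8645 : ℝ) ≤ memGrowth 3 4 := le_memGrowth_four_of_cubic_nonpos (d := 3) (by norm_num) (by norm_num) (by norm_num)
  have hμhi : memGrowth 3 4 ≤ 4.86454 := memGrowth_four_zd3_le
  have hμpos : (0 : ℝ) < memGrowth 3 4 := by linarith
  have hq : (0 : ℝ) < (2 * ((3 : ℕ) : ℝ) - 1) / memGrowth 3 4 := div_pos (by norm_num) hμpos
  have hlog := Real.one_sub_inv_le_log_of_pos hq
  rw [inv_div] at hlog
  have h1 : memGrowth 3 4 / (2 * ((3 : ℕ) : ℝ) - 1) ≤ 0.972908 := by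
    rw [div_le_iff₀ (by norm_num : (0 : ℝ) < 2 * ((3 : ℕ) : ℝ) - 1)]
    norm_num
    linarith
  have hc : (0 : ℝ) < (2 * ((3 : ℕ) : ℝ) - 1) ^ 4 / (2 * ((3 : ℕ) : ℝ) * (2 * ((3 : ℕ) : ℝ) - 2)) := by norm_num
  have hc' : (2 * ((3 : ℕ) : ℝ) - 1) ^ 4 / (2 * ((3 : ℕ) : ℝ) * (2 * ((3 : ℕ) : ℝ) - 2)) = 625 / 24 := by norm_num
  rw [hc']
  nlinarith

/-- **`R_4(ℤ³) ≤ 0.73`** (`ln t ≤ t − 1` with `μ_4(ℤ³) ≥ 4.8645`; measured 0.7153; the all-`d` bound `R_4 < 1` is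
…BondRungFour). [this work] -/
theorem loopCompat_four_zd3_le : loopCompat 3 4 ≤ 0.73 := by
  rw [loopCompat_four_eq (d := 3) (by norm_num)]
  have hμlo : (4.8645 : ℝ) ≤ memGrowth 3 4 := le_memGrowth_four_of_cubic_nonpos (d := 3) (by norm_num) (by norm_num) (by norm_num)
  have hμpos : (0 : ℝ) < memGrowth 3 4 := by linarith
  have hq : (0 : ℝ) < (2 * ((3 : ℕ) : ℝ) - 1) / memGrowth 3 4 := div_pos (by norm_num) hμpos
  have hlog := Real.log_le_sub_one_of_pos hq
  have h1 : (2 * ((3 : ℕ) : ℝ) - 1) / memGrowth 3 4 ≤ 1.02786 := by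
    rw [div_le_iff₀ hμpos]
    norm_num
    linarith
  have hc' : (2 * ((3 : ℕ) : ℝ) - 1) ^ 4 / (2 * ((3 : ℕ) : ℝ) * (2 * ((3 : ℕ) : ℝ) - 2)) = 625 / 24 := by norm_num
  rw [hc']
  nlinarith

/-- **`R_6(ℤ³) < R_4(ℤ³)`**: clause (c) of the typed law C4 at its first instance. [this work] -/
theorem loopCompat_six_lt_four_zd3 : loopCompat 3 6 < loopCompat 3 4 :=
  lt_of_le_of_lt loopCompat_six_zd3_le (lt_of_lt_of_le (by norm_num) loopCompat_four_zd3_ge)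

/-- `loopCompatStrictAntiMemory` at `(d, m) = (3, 2)`: `R_{2·2+2}(3) < R_{2·2}(3)`. [this work] -/
theorem loopCompatStrictAntiMemory_three_two : loopCompat 3 (2 * 2 + 2) < loopCompat 3 (2 * 2) :=
  loopCompat_six_lt_four_zd3

/-- `loopCompatWindow` at `(d, m) = (3, 3)`: `0 < R_6(ℤ³) < 1`. [this work] -/
theorem loopCompatWindow_three_three : 0 < loopCompat 3 (2 * 3) ∧ loopCompat 3 (2 * 3) < 1 :=
  ⟨loopCompat_six_zd3_pos, lt_of_le_of_lt loopCompat_six_zd3_le (by norm_num)⟩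

end Summit.CriticalPhenomena.PercolationContinuityZ3.Theorems.Pcint.MemoryTail
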